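import Summits.QuantumFields.YangMills.Theorems.OneCertifiedCubeFiniteSizeCriterion
import HarnessLib

/-!
# `NonSimplyConnectedLatticeGap` — mixing for GOOD exterior data + rarity of bad data ⇒ the averaged leaf
# (stub `stub_meanBoxInfluence_le_of_goodSet` of line `Sketch` v9, crux stmt-QuantumFields-16405, route `ConvexGribovBody`)

Fix a compact metrisable group `G`, a continuous representation `ρ`, `β`, a gauge-invariant local observable `A` with
`|A| ≤ C_A` supported in the cube `Λ_L = [−L,L]⁴ × (4 directions)` of links, and a torus `(2S+1)⁴` with `S ≥ L + 1`.
Write `g(η) = γ_{Λ_L}(A | η)` for the kernel mean of the Wilson specification `ymSpecification ρ β Λ_L`, `Ũ` for the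
periodic lift `torusLift (2S+1) U` and `μ_S` for the torus Wilson state. If `g` varies by at most `δ` over a measurable set
`Good` of exterior data and `μ_S(Ũ ∉ Good) ≤ ε`, then `∫ |g(Ũ) − μ_S(A)| dμ_S(U) ≤ 2δ + 4 C_A ε`.

Proof. The cube, the support of `A` and the collar of the cube inject into the torus (`L + 1 ≤ S`), so the far-factor
DLR identity on the torus with far factor `1`
(`FiniteSizeCriterion.integral_torusLift_mul_eq_integral_ymSpecification_mul_of_measurable`) gives
`μ_S(A) = ∫ g(Ũ) dμ_S`. Choose a reference value `c`: `c = g(Ṽ₀)` for a torus configuration with `Ṽ₀ ∈ Good` if there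
is one, `c = 0` otherwise; in both cases `|g(Ũ) − c| ≤ δ + 2 C_A 1_{Ũ ∉ Good}` pointwise, whence
`∫ |g(Ũ) − c| dμ_S ≤ δ + 2 C_A ε`, and `∫ |g(Ũ) − μ_S(A)| dμ_S ≤ ∫ |g(Ũ) − c| dμ_S + |c − ∫ g(Ũ) dμ_S| ≤ 2 ∫ |g(Ũ) − c| dμ_S`.

References: H.-O. Georgii, *Gibbs Measures and Phase Transitions*, 2nd ed. (de Gruyter 2011), Thm. 4.17, §8.2.
-/

set_option autoImplicit false

noncomputable section

open MeasureTheory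
open Literature.Probability.LatticeModels
open Literature.MathematicalPhysics.QuantumLattice
open Literature.MathematicalPhysics.QuantumFieldTheory (GaugeConfig wilsonMeasure isProbabilityMeasure_wilsonMeasure
  measurable_torusLift isSpecification_ymSpecification_of_t2Space)

namespace Summit.QuantumFields.YangMills.Theorems.NonSimplyConnectedLatticeGap

/-- For a probability measure, a measurable `f` with `|f| ≤ C` and any constant `c`: the `L¹` oscillation of `f` around
its mean is at most twice its `L¹` distance to `c`, `∫ |f − ∫ f| ≤ 2 ∫ |f − c|`. -/
theorem integral_abs_sub_integral_le_two_mul {X : Type*} [MeasurableSpace X] (μ : Measure X)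
    [IsProbabilityMeasure μ] {f : X → ℝ} (hfm : Measurable f) {C : ℝ} (hfb : ∀ x, |f x| ≤ C) (c : ℝ) :
    ∫ x, |f x - ∫ y, f y ∂μ| ∂μ ≤ 2 * ∫ x, |f x - c| ∂μ := by
  have hfi : Integrable f μ := integrable_of_abs_le hfm hfb
  have hfc : Integrable (fun x => |f x - c|) μ := (hfi.sub (integrable_const c)).abs
  -- the mean is within `∫ |f - c|` of `c`
  have hcm : |c - ∫ y, f y ∂μ| ≤ ∫ x, |f x - c| ∂μ := by
    have e : c - ∫ y, f y ∂μ = ∫ x, (c - f x) ∂μ := by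
      rw [integral_sub (integrable_const c) hfi, integral_const]
      simp
    rw [e]
    calc |∫ x, (c - f x) ∂μ| ≤ ∫ x, |c - f x| ∂μ := abs_integral_le_integral_abs
      _ = ∫ x, |f x - c| ∂μ := by simp_rw [abs_sub_comm c]
  calc ∫ x, |f x - ∫ y, f y ∂μ| ∂μ ≤ ∫ x, (|f x - c| + |c - ∫ y, f y ∂μ|) ∂μ :=
        integral_mono (hfi.sub (integrable_const _)).abs (hfc.add (integrable_const _))
          fun x => abs_sub_le _ _ _
    _ = (∫ x, |f x - c| ∂μ) + |c - ∫ y, f y ∂μ| := by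
        rw [integral_add hfc (integrable_const _), integral_const]
        simp
    _ ≤ 2 * ∫ x, |f x - c| ∂μ := by linarith only [hcm]

/-- For a probability measure, a measurable set `B` and constants `0 ≤ a`, `0 ≤ b`: if `|h| ≤ a` off `B` and `|h| ≤ a + b`
on `B`, then `∫ |h| ≤ a + b μ(B)`. -/
theorem integral_abs_le_of_le_off_on {X : Type*} [MeasurableSpace X] (μ : Measure X) [IsProbabilityMeasure μ]
    {h : X → ℝ} (hhm : Measurable h) {B : Set X} (hB : MeasurableSet B) {a b : ℝ} (hb : 0 ≤ b)
    (hoff : ∀ x, x ∉ B → |h x| ≤ a) (hon : ∀ x, x ∈ B → |h x| ≤ a + b) :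
    ∫ x, |h x| ∂μ ≤ a + b * (μ B).toReal := by
  have hpt : ∀ x, |h x| ≤ a + b * B.indicator 1 x := fun x => by
    by_cases hx : x ∈ B
    · rw [Set.indicator_of_mem hx]
      simpa using hon x hx
    · rw [Set.indicator_of_notMem hx]
      simpa using hoff x hx
  have hab : ∀ x, |h x| ≤ a + b := fun x => (hpt x).trans (by
    by_cases hx : x ∈ B
    · simp [Set.indicator_of_mem hx]
    · simp [Set.indicator_of_notMem hx, hb])
  have hhi : Integrable (fun x => |h x|) μ := (integrable_of_abs_le hhm hab).abs
  have hind : Integrable (fun x => B.indicator (1 : X → ℝ) x) μ :=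
    (integrable_const (1 : ℝ)).indicator hB
  calc ∫ x, |h x| ∂μ ≤ ∫ x, (a + b * B.indicator 1 x) ∂μ :=
        integral_mono hhi ((integrable_const a).add (hind.const_mul b)) hpt
    _ = a + b * (μ B).toReal := by
        rw [integral_add (integrable_const a) (hind.const_mul b), integral_const, integral_const_mul,
          integral_indicator_one hB]
        simp [measureReal_def]

/-- **Mixing for GOOD exterior data + rarity of bad data ⇒ the averaged leaf** (registered stub
`stub_meanBoxInfluence_le_of_goodSet` of the skeleton `Cruxes/NonSimplyConnectedLatticeGap/Lines/Sketch.lean` v9 of item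
stmt-QuantumFields-16405): if the kernel means `γ_{Λ_L}(A | η)` vary by `≤ δ` over a measurable set `Good` of exterior data
and `μ_S(Ũ ∉ Good) ≤ ε`, then the `L¹(μ_S)` oscillation of `γ_{Λ_L}(A | Ũ)` around the torus mean `μ_S(A)` is
`≤ 2δ + 4 C_A ε` (DLR on the torus with far factor `1`, reference datum in `Good`, split of the integral). -/
theorem stub_meanBoxInfluence_le_of_goodSet : ∀ (G : Type) [Group G] [TopologicalSpace G] [IsTopologicalGroup G] [CompactSpace G] [MeasurableSpace G] [BorelSpace G] [SecondCountableTopology G] [T2Space G] (N : ℕ) (ρ : G →* Matrix (Fin N) (Fin N) ℂ), Continuous ρ → ∀ (β : ℝ) (A : Literature.MathematicalPhysics.QuantumLattice.LocalGaugeObservable 4 G) (CA : ℝ), (∀ U, |A.F U| ≤ CA) → ∀ (L S : ℕ), A.supp ⊆ ((Fintype.piFinset fun _ : Fin 4 => Finset.Icc (-((L : ℕ) : ℤ)) ((L : ℕ) : ℤ)) ×ˢ (Finset.univ : Finset (Fin 4))) → L + 1 ≤ S → ∀ (Good : Set (Literature.MathematicalPhysics.QuantumLattice.LGConfig 4 G)),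 MeasurableSet Good → ∀ (δ ε : ℝ), 0 ≤ δ → (∀ η ∈ Good, ∀ η' ∈ Good, |(∫ U, A.F U ∂(Literature.MathematicalPhysics.QuantumLattice.ymSpecification ρ β ((Fintype.piFinset fun _ : Fin 4 => Finset.Icc (-((L : ℕ) : ℤ)) ((L : ℕ) : ℤ)) ×ˢ (Finset.univ : Finset (Fin 4))) η)) - ∫ U, A.F U ∂(Literature.MathematicalPhysics.QuantumLattice.ymSpecification ρ β ((Fintype.piFinset fun _ : Fin 4 => Finset.Icc (-((L : ℕ) : ℤ)) ((L : ℕ) : ℤ)) ×ˢ (Finset.univ : Finset (Fin 4))) η')| ≤ δ) → ((Literature.MathematicalPhysics.QuantumFieldTheory.wilsonMeasure (d := 4) (L := 2 * S + 1) ρ β) {V | Literature.MathematicalPhysics.QuantumLattice.torusLift (2 * S + 1) V ∉ Good}).toReal ≤ ε → ∫ V, |(∫ U, A.F U ∂(Literature.MathematicalPhysics.QuantumLattice.ymSpecification ρ β ((Fintype.piFinset fun _ : Fin 4 => Finset.Icc (-((L : ℕ) : ℤ)) ((L : ℕ) : ℤ)) ×ˢ (Finset.univ : Finset (Fin 4)))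 (Literature.MathematicalPhysics.QuantumLattice.torusLift (2 * S + 1) V))) - ∫ W, A.F (Literature.MathematicalPhysics.QuantumLattice.torusLift (2 * S + 1) W) ∂(Literature.MathematicalPhysics.QuantumFieldTheory.wilsonMeasure (d := 4) (L := 2 * S + 1) ρ β)| ∂(Literature.MathematicalPhysics.QuantumFieldTheory.wilsonMeasure (d := 4) (L := 2 * S + 1) ρ β) ≤ 2 * δ + 4 * CA * ε := by
  intro G _ _ _ _ _ _ _ _ N ρ hρ β A CA hCA L S hsupp hLS Good hGood δ ε hδ hvar hε
  classical
  haveI := isProbabilityMeasure_wilsonMeasure (d := 4) (L := 2 * S + 1) ρ hρ β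
  have hγ := isSpecification_ymSpecification_of_t2Space (d := 4) ρ hρ β
  have hCA0 : 0 ≤ CA := (abs_nonneg _).trans (hCA fun _ => 1)
  -- the cube `Λ` of radius `L`
  obtain ⟨Λ, hΛ⟩ : ∃ Λ : Finset (ZdEdge 4), Λ = (Fintype.piFinset fun _ : Fin 4 =>
    Finset.Icc (-((L : ℕ) : ℤ)) ((L : ℕ) : ℤ)) ×ˢ (Finset.univ : Finset (Fin 4)) := ⟨_, rfl⟩
  rw [← hΛ] at hsupp hvar ⊢
  have hmemΛ : ∀ e ∈ Λ, ∀ i, -(L : ℤ) ≤ e.1 i ∧ e.1 i ≤ L := by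
    intro e he i
    rw [hΛ, Finset.mem_product, Fintype.mem_piFinset] at he
    exact Finset.mem_Icc.1 (he.1 i)
  -- the kernel mean `g` of `A`, its measurability and bound
  set g : LGConfig 4 G → ℝ := fun η => ∫ U, A.F U ∂(ymSpecification ρ β Λ η) with hgdef
  have hgm : Measurable g := DobrushinShlosman.measurable_windowAvg' hγ Λ A.measurable
  have hgb : ∀ η, |g η| ≤ CA := fun η => abs_integral_ymSpecification_le ρ hρ β Λ hCA η
  have hgl : Measurable fun V : GaugeConfig 4 (2 * S + 1) G => g (torusLift (2 * S + 1) V) :=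
    hgm.comp (measurable_torusLift (2 * S + 1))
  have hvar' : ∀ η ∈ Good, ∀ η' ∈ Good, |g η - g η'| ≤ δ := hvar
  -- (i) `Λ`, the support of `A` and the collar of `Λ` inject into the torus (`L + 1 ≤ S`)
  have hLS' : (L : ℤ) + 1 ≤ S := by exact_mod_cast hLS
  have hwide : ∀ e ∈ Λ ∪ A.supp ∪ (plaquettesTouching Λ).biUnion plaquetteEdges, ∀ i,
      -(L : ℤ) - 1 ≤ e.1 i ∧ e.1 i ≤ L + 1 := by
    intro e he i
    simp only [Finset.mem_union] at he
    rcases he with (he | he) | he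
    · have h := hmemΛ e he i
      constructor <;> linarith only [h.1, h.2]
    · have h := hmemΛ e (hsupp he) i
      constructor <;> linarith only [h.1, h.2]
    · obtain ⟨e', he', hn'⟩ := exists_near_of_mem_collar he
      have h := hmemΛ e' he' i
      have h' := hn' i
      constructor <;> linarith only [h.1, h.2, h'.1, h'.2]
  have hinj : Set.InjOn (Torus.proj (2 * S + 1))
      ((Λ ∪ A.supp ∪ (plaquettesTouching Λ).biUnion plaquetteEdges).image Prod.fst :
        Set (Site 4)) := by
    refine (FiniteSizeCriterion.injOn_torusProj_of_width (M := 2 * S + 1) (lo := -(L : ℤ) - 1)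
      (hi := (L : ℤ) + 1) (by push_cast; linarith only [hLS'])).mono fun x hx => ?_
    obtain ⟨e, he, rfl⟩ := Finset.mem_image.1 (Finset.mem_coe.1 hx)
    exact hwide e he
  -- (ii) DLR on the torus with far factor `1`: the torus mean of `A` is the torus mean of `g ∘ lift`
  have hDLR := FiniteSizeCriterion.integral_torusLift_mul_eq_integral_ymSpecification_mul_of_measurable
    ρ hρ β Λ A.measurable hCA A.isCylinder hinj (H := fun _ => (1 : ℝ)) measurable_const (D := 1)
    (fun _ => by simp) (fun _ _ => rfl)
  simp only [mul_one] at hDLR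
  have hmean : (∫ W, A.F (torusLift (2 * S + 1) W) ∂(wilsonMeasure (d := 4) (L := 2 * S + 1) ρ β)) =
      ∫ V, g (torusLift (2 * S + 1) V) ∂(wilsonMeasure (d := 4) (L := 2 * S + 1) ρ β) := hDLR
  -- (iii) the bad set and a reference value `c` with `|g(lift V) - c| ≤ δ` off it, `≤ δ + 2 C_A` on it
  have hBad : MeasurableSet {V : GaugeConfig 4 (2 * S + 1) G | torusLift (2 * S + 1) V ∉ Good} :=
    (measurable_torusLift (2 * S + 1)) hGood.compl
  obtain ⟨c, hoff, hon⟩ : ∃ c : ℝ,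
      (∀ V : GaugeConfig 4 (2 * S + 1) G, V ∉ {V | torusLift (2 * S + 1) V ∉ Good} →
        |g (torusLift (2 * S + 1) V) - c| ≤ δ) ∧
      (∀ V : GaugeConfig 4 (2 * S + 1) G, V ∈ {V | torusLift (2 * S + 1) V ∉ Good} →
        |g (torusLift (2 * S + 1) V) - c| ≤ δ + 2 * CA) := by
    by_cases hex : ∃ V₀ : GaugeConfig 4 (2 * S + 1) G, torusLift (2 * S + 1) V₀ ∈ Good
    · obtain ⟨V₀, hV₀⟩ := hex
      refine ⟨g (torusLift (2 * S + 1) V₀), fun V hV => ?_, fun V _ => ?_⟩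
      · have hV' : torusLift (2 * S + 1) V ∈ Good := by
          by_contra h
          exact hV h
        exact hvar' _ hV' _ hV₀
      · have h1 := hgb (torusLift (2 * S + 1) V)
        have h2 := hgb (torusLift (2 * S + 1) V₀)
        have h3 := abs_sub (g (torusLift (2 * S + 1) V)) (g (torusLift (2 * S + 1) V₀))
        linarith only [h1, h2, h3, hδ]
    · push Not at hex
      refine ⟨0, fun V hV => absurd (hex V) hV, fun V _ => ?_⟩
      rw [sub_zero]
      linarith only [hgb (torusLift (2 * S + 1) V), hCA0, hδ]
  -- (iv) integrate
  have hc : ∫ V, |g (torusLift (2 * S + 1) V) - c| ∂(wilsonMeasure (d := 4) (L := 2 * S + 1) ρ β) ≤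
      δ + 2 * CA * ε := by
    have h : ∫ V, |g (torusLift (2 * S + 1) V) - c| ∂(wilsonMeasure (d := 4) (L := 2 * S + 1) ρ β) ≤
        δ + 2 * CA * ((wilsonMeasure (d := 4) (L := 2 * S + 1) ρ β)
          {V : GaugeConfig 4 (2 * S + 1) G | torusLift (2 * S + 1) V ∉ Good}).toReal :=
      integral_abs_le_of_le_off_on (wilsonMeasure (d := 4) (L := 2 * S + 1) ρ β)
        (h := fun V => g (torusLift (2 * S + 1) V) - c) (hgl.sub_const c) hBad (b := 2 * CA)
        (by positivity) hoff hon
    have h2 : 2 * CA * ((wilsonMeasure (d := 4) (L := 2 * S + 1) ρ β)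
        {V : GaugeConfig 4 (2 * S + 1) G | torusLift (2 * S + 1) V ∉ Good}).toReal ≤ 2 * CA * ε :=
      mul_le_mul_of_nonneg_left hε (by positivity)
    linarith only [h, h2]
  have hosc := integral_abs_sub_integral_le_two_mul (wilsonMeasure (d := 4) (L := 2 * S + 1) ρ β) hgl
    (fun V => hgb _) c
  change ∫ V, |g (torusLift (2 * S + 1) V) - ∫ W, A.F (torusLift (2 * S + 1) W)
      ∂(wilsonMeasure (d := 4) (L := 2 * S + 1) ρ β)| ∂(wilsonMeasure (d := 4) (L := 2 * S + 1) ρ β) ≤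
    2 * δ + 4 * CA * ε
  rw [hmean]
  calc ∫ V, |g (torusLift (2 * S + 1) V) - ∫ W, g (torusLift (2 * S + 1) W)
        ∂(wilsonMeasure (d := 4) (L := 2 * S + 1) ρ β)| ∂(wilsonMeasure (d := 4) (L := 2 * S + 1) ρ β)
      ≤ 2 * ∫ V, |g (torusLift (2 * S + 1) V) - c| ∂(wilsonMeasure (d := 4) (L := 2 * S + 1) ρ β) := hosc
    _ ≤ 2 * (δ + 2 * CA * ε) := by linarith only [hc]
    _ = 2 * δ + 4 * CA * ε := by ring

end Summit.QuantumFields.YangMills.Theorems.NonSimplyConnectedLatticeGap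

end
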